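import Summits.Ventures.PercRepro.S1Kill

/-!
# PercRepro — A CELL BY THE KILL LEVER: THE GENERIC CASE (p2, gen 22; SUBCLAIM-S1 §6.6)

The coloop-free case of a cell `(p, d)` with the kill of `m` small circuits on the `Y`-side: the cell form's
`U`-bound (S1CellBounds) at the ACTUAL triangle count `t = s₃` and the `Y`-bound of S1Kill with `m ≤ t` triangles
turn into the kernel condition `ladderOK p p d t S S5 (m·C(n − 3, p − 3)) (C(m, 2)·C(n − 5, p − 5))`; one such
evaluation per `t ∈ [1, P]` (with a chosen `m = mk t`) and one plain evaluation at `t = 0` close the case.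
A variant takes the four-circuits at `t = 0` (`rls_of_kill_case_four`).

* `cellYsum_kill_le` — the cell form's `Y`-bound with the kill, in the capped numbers `cellYsum`, `cellR34`;
* `weighted_of_ladderOK_kill` — what `ladderOK` with the kill credit means on a capped core;
* **`rls_of_kill_case`**, **`rls_of_kill_case_four`** — `RLS` at `(p, 4)` for a coloop-free core from the kernel lines.
Axioms: standard.
-/

open scoped Matroid

namespace PercRepro

namespace S1

open Set

variable {α : Type}

/-- **The cell form's `Y`-bound with the kill**: on the capped core, for `m` circuits of size `k ≤ p` pairwise
covering `≥ 5` points, `cellYsum + 7560·m·C(n − k, p − k) ≤ 7560·#Y(p, 4) + cellR34 + 7560·C(m, 2)·C(n − 5, p − 5)`. -/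
theorem cellYsum_kill_le (M : Matroid α) [M.Finite] (p d P S S5 : ℕ) (hd4 : 4 ≤ d) (hR : M.eRank = (p : ℕ∞))
    (hn : M.E.ncard = p + d)
    (hfree : ∀ e ∈ M.E, ∃ A ⊆ M.E \ {e}, e ∉ M.closure A ∧ e ∉ M.closure ((M.E \ {e}) \ A))
    (hP : {C : Set α | M.IsCircuit C ∧ C.ncard = 3}.ncard ≤ P) (hS : {C : Set α | M.IsCircuit C ∧ C.ncard = 4}.ncard ≤ S)
    (hS5 : {C : Set α | M.IsCircuit C ∧ C.ncard = 5}.ncard ≤ S5)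
    (hp : 5 ≤ p) (k : ℕ) (hkp : k ≤ p) (𝒯 : Finset (Set α)) (h𝒯 : ∀ C ∈ 𝒯, M.IsCircuit C ∧ C.ncard = k)
    (hpair : ∀ C ∈ 𝒯, ∀ C' ∈ 𝒯, C ≠ C' → 5 ≤ (C ∪ C').ncard) :
    cellYsum p d + 7560 * (𝒯.card * (p + d - k).choose (p - k)) ≤
      7560 * Matroid.midCount M p 4 + cellR34 p d P S S5 + 7560 * (𝒯.card.choose 2 * (p + d - 5).choose (p - 5)) := by
  unfold cellR34 cellYsum
  simp only [CoreRegimes.chooseF_eq]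
  classical
  have hL : ∀ e ∈ M.E, ¬ M.IsLoop e := ThmN.not_isLoop_of_free M hfree
  have hs : ∀ e ∈ M.E, ∀ f ∈ M.E, e ≠ f → M.eRk {e, f} = 2 := by
    intro e he f hf hef
    have h2 : (2 : ℕ∞) ≤ M.eRk {e, f} :=
      ThmN.two_le_eRk_of_two_le_ncard_of_free M hfree (pair_subset he hf) (by rw [ncard_pair hef])
    have h3 : M.eRk {e, f} ≤ 2 := by
      have := M.eRk_le_encard {e, f}
      rwa [encard_pair hef] at this
    exact le_antisymm h3 h2
  have hcirc : ∀ C, M.IsCircuit C → 3 ≤ C.encard := ThmN.three_le_encard_of_circuit M hL hs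
  have hline : ∀ L ⊆ M.E, M.eRk L ≤ 2 → L.ncard ≤ 3 := by
    intro L hL' hr
    have := ThmN.ncard_add_one_le_two_pow_of_eRk_le M hL hfree 2 L hL' hr
    omega
  have hplane : ∀ P ⊆ M.E, M.eRk P ≤ 3 → P.ncard ≤ 6 := fun P hP hr =>
    ThmN.ncard_le_six_of_eRk_le_three_of_free M hfree hP hr
  have hten : ∀ X ⊆ M.E, M.eRk X ≤ 4 → X.ncard ≤ 10 := fun X hX hr =>
    ThmN.ncard_le_ten_of_eRk_le_four_of_free M hfree hX hr
  have hd : M.E.encard = M.eRank + d := by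
    rw [hR, ← M.ground_finite.cast_ncard_eq, hn]
    push_cast
    ring
  set s3 := {C : Set α | M.IsCircuit C ∧ C.ncard = 3}.ncard with hs3
  set s4 := {C : Set α | M.IsCircuit C ∧ C.ncard = 4}.ncard with hs4
  set s5 := {C : Set α | M.IsCircuit C ∧ C.ncard = 5}.ncard with hs5
  have hb3 : s3 ≤ min (min (d * (d + 1) / 2) ((d * d + 6 - 3 * d) / 2)) P := by
    have h := two_mul_ncard_triangles_le M (fun L hL hr => hline L hL hr.le) hd
    have h' : 2 * s3 ≤ d * (d + 1) := h
    have h2 := two_mul_ncard_triangles_add_three_mul_le_of_four_le M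
      (fun L hL hr => hline L hL hr.le) hplane hd4 hd
    have h2' : 2 * s3 + 3 * d ≤ d * d + 6 := h2
    refine le_min (le_min ?_ ?_) hP
    · rw [Nat.le_div_iff_mul_le (by norm_num)]; omega
    · rw [Nat.le_div_iff_mul_le (by norm_num)]; omega
  have hb4 : s4 ≤ min (min (min ((d + 3).choose 4) (d * (d + 1) * (d + 2) / 3)) (fourCircuitBound d)) S := by
    refine le_min (le_min (le_min (ncard_circuits_four_le M hd) ?_) (ncard_fourCircuits_le_fourCircuitBound M hfree hd)) hS
    have h := three_mul_ncard_four_circuits_le M hline hplane hd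
    have h' : 3 * s4 ≤ d * (d + 1) * (d + 2) := h
    rw [Nat.le_div_iff_mul_le (by norm_num)]
    omega
  have hb5 : s5 ≤ min ((d + 4).choose 5) S5 := le_min (ncard_circuits_five_le M hd) hS5
  have hY := midCount_ge_K7_kill M hcirc hline hplane hten hd p hp k hkp 𝒯 h𝒯 hpair
  rw [hn] at hY
  set m := min (5 * d) (p + d) with hm
  set s3B := min (min (d * (d + 1) / 2) ((d * d + 6 - 3 * d) / 2)) P with hs3B
  set s4B := min (min (min ((d + 3).choose 4) (d * (d + 1) * (d + 2) / 3)) (fourCircuitBound d)) S with hs4B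
  set s5B := min ((d + 4).choose 5) S5 with hs5B
  set piAll := s3 * (p + d - 3).choose 2 + s4 * (p + d - 4) + s5 with hpiAll
  set piS0 := s3 * (m - 3).choose 2 + s4 * (m - 4) + s5 with hpiS0
  set piAllB := s3B * (p + d - 3).choose 2 + s4B * (p + d - 4) + s5B with hpiAllB
  set piS0B := s3B * (m - 3).choose 2 + s4B * (m - 4) + s5B with hpiS0B
  have hpiAll_le : piAll ≤ piAllB := by
    rw [hpiAll, hpiAllB]; gcongr
  have hpiS0_le : piS0 ≤ piS0B := by
    rw [hpiS0, hpiS0B]; gcongr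
  have hR3_le : 10584 * (s3 * (p + d - 3) + s4) ≤ 10584 * (s3B * (p + d - 3) + s4B) := by
    gcongr
  have hR4_le : RSK 10 * piAll + (RBK 10 - RSK 10) * piS0 ≤ RSK 10 * piAllB + (RBK 10 - RSK 10) * piS0B := by
    gcongr
  have hY' : 7560 * (∑ j ∈ Finset.Ico 5 p, (p + d).choose j + 𝒯.card * (p + d - k).choose (p - k)) ≤
      7560 * Matroid.midCount M p 4 + 10584 * (s3 * (p + d - 3) + s4) +
      (RSK 10 * piAll + (RBK 10 - RSK 10) * piS0) +
      7560 * (𝒯.card.choose 2 * (p + d - 5).choose (p - 5)) := hY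
  omega

/-- **What `ladderOK` with the kill credit means**: on the capped core `N` of rank `p` with `m` circuits of size
`k` pairwise covering `≥ 5` points, `Φ(p0, 4)·#U_N(p, 4) + B ≤ #Y_N(p, 4) + A` once
`ladderOK p0 p d P S S5 (A + m·C(n − k, p − k)) (B + C(m, 2)·C(n − 5, p − 5)) = true`. -/
theorem weighted_of_ladderOK_kill (N : Matroid α) [N.Finite] (p0 p d P S S5 A B : ℕ) (hd4 : 4 ≤ d)
    (hR : N.eRank = (p : ℕ∞)) (hn : N.E.ncard = p + d)
    (hfree : ∀ e ∈ N.E, ∃ X ⊆ N.E \ {e}, e ∉ N.closure X ∧ e ∉ N.closure ((N.E \ {e}) \ X))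
    (hP : {C : Set α | N.IsCircuit C ∧ C.ncard = 3}.ncard ≤ P) (hS : {C : Set α | N.IsCircuit C ∧ C.ncard = 4}.ncard ≤ S)
    (hS5 : {C : Set α | N.IsCircuit C ∧ C.ncard = 5}.ncard ≤ S5)
    (hp : 5 ≤ p) (hp0 : 5 ≤ p0) (k : ℕ) (hkp : k ≤ p) (𝒯 : Finset (Set α))
    (h𝒯 : ∀ C ∈ 𝒯, N.IsCircuit C ∧ C.ncard = k) (hpair : ∀ C ∈ 𝒯, ∀ C' ∈ 𝒯, C ≠ C' → 5 ≤ (C ∪ C').ncard)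
    (hok : ladderOK p0 p d P S S5 (A + 𝒯.card * (p + d - k).choose (p - k))
      (B + 𝒯.card.choose 2 * (p + d - 5).choose (p - 5)) = true) :
    phiK p0 4 * (Matroid.topCount N p 4 : ℚ) + B ≤ (Matroid.midCount N p 4 : ℚ) + A := by
  have hUB := (cell_bounds N p d P S S5 hd4 hR hn hfree hP hS hS5 hp).1
  have hYB := cellYsum_kill_le N p d P S S5 hd4 hR hn hfree hP hS hS5 hp k hkp 𝒯 h𝒯 hpair
  unfold ladderOK at hok
  simp only [CoreRegimes.chooseF_eq] at hok
  have hok' := of_decide_eq_true hok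
  set phiNum := 2 ^ (p0 + 4) - 2 * ∑ u ∈ Finset.range 5, (p0 + 4).choose u with hphiNum
  set phiDen := (p0 + 4).choose 4 with hphiDen
  set UB := cellUB p d P S S5
  set R34 := cellR34 p d P S S5
  set Ysum := cellYsum p d
  set T := Matroid.topCount N p 4
  set Y := Matroid.midCount N p 4
  set KA := 𝒯.card * (p + d - k).choose (p - k) with hKA
  set KB := 𝒯.card.choose 2 * (p + d - 5).choose (p - 5) with hKB
  -- the `ℕ` chain
  have h1 : phiNum * (7560 * T) ≤ phiNum * UB := Nat.mul_le_mul_left _ hUB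
  have h2 : phiDen * (Ysum + 7560 * KA) ≤ phiDen * (7560 * Y + R34 + 7560 * KB) := Nat.mul_le_mul_left _ hYB
  have hchain : phiNum * (7560 * T) + phiDen * (7560 * B) ≤ phiDen * (7560 * Y) + phiDen * (7560 * A) := by
    have e1 : phiDen * (R34 + 7560 * (B + KB)) = phiDen * R34 + phiDen * (7560 * B) + phiDen * (7560 * KB) := by ring
    have e2 : phiDen * (Ysum + 7560 * (A + KA)) = phiDen * Ysum + phiDen * (7560 * A) + phiDen * (7560 * KA) := by ring
    have e3 : phiDen * (7560 * Y + R34 + 7560 * KB) = phiDen * (7560 * Y) + phiDen * R34 + phiDen * (7560 * KB) := by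
      ring
    have e4 : phiDen * (Ysum + 7560 * KA) = phiDen * Ysum + phiDen * (7560 * KA) := by ring
    rw [e1, e2] at hok'
    rw [e3, e4] at h2
    omega
  -- to `ℚ`
  have hsum : 2 * ∑ u ∈ Finset.range 5, (p0 + 4).choose u ≤ 2 ^ (p0 + 4) := by
    have := sum_Ioo_choose_add_four p0 hp0
    omega
  have hphiNumQ : (phiNum : ℚ) = 2 ^ (p0 + 4) - 2 * ∑ u ∈ Finset.range 5, ((p0 + 4).choose u : ℚ) := by
    rw [hphiNum, Nat.cast_sub hsum]
    push_cast
    ring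
  have hΦ := phiK_four_mul_choose_eq p0 hp0
  rw [← hphiNumQ] at hΦ
  have hDenPos : (0 : ℚ) < (phiDen : ℚ) := by
    rw [hphiDen]; exact_mod_cast Nat.choose_pos (by omega)
  have hchainQ : (phiNum : ℚ) * (7560 * (T : ℚ)) + (phiDen : ℚ) * (7560 * (B : ℚ)) ≤
      (phiDen : ℚ) * (7560 * (Y : ℚ)) + (phiDen : ℚ) * (7560 * (A : ℚ)) := by
    have h : ((phiNum * (7560 * T) + phiDen * (7560 * B) : ℕ) : ℚ) ≤
        ((phiDen * (7560 * Y) + phiDen * (7560 * A) : ℕ) : ℚ) := by exact_mod_cast hchain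
    push_cast at h
    linarith
  have hkey : (phiK p0 4 * (T : ℚ) + (B : ℚ)) * (phiDen : ℚ) ≤ ((Y : ℚ) + (A : ℚ)) * (phiDen : ℚ) := by
    have e : (phiK p0 4 * (T : ℚ) + (B : ℚ)) * (phiDen : ℚ) =
        (phiK p0 4 * (phiDen : ℚ)) * (T : ℚ) + (phiDen : ℚ) * (B : ℚ) := by ring
    rw [e, hphiDen, hΦ, ← hphiDen]
    nlinarith [hchainQ]
  exact le_of_mul_le_mul_right hkey hDenPos

/-- `m ≤ #𝒮` members of a set of circuits, as a finset of `m` of them. -/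
theorem exists_finset_of_le_ncard {𝒮 : Set (Set α)} {m : ℕ} (hm : 1 ≤ m) (h : m ≤ 𝒮.ncard) :
    ∃ 𝒯 : Finset (Set α), 𝒯.card = m ∧ ∀ C ∈ 𝒯, C ∈ 𝒮 := by
  obtain ⟨T, hTsub, hTcard⟩ := Set.exists_subset_card_eq h
  have hTfin : T.Finite := Set.finite_of_ncard_ne_zero (by omega)
  refine ⟨hTfin.toFinset, ?_, ?_⟩
  · rw [← Set.ncard_eq_toFinset_card _ hTfin, hTcard]
  · intro C hC
    rw [Set.Finite.mem_toFinset] at hC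
    exact hTsub hC

/-- **THE COLOOP-FREE CASE OF A CELL BY THE KILL LEVER** (the `c = 0` case of the coloop ladder): a coloop-free
`e`-free core of rank `p ≥ 5` on `p + d` points (`d ≥ 4`) with the lever caps `P` (triangles), `S` (four-circuits,
supplied) and `S5` (five-circuits) satisfies `RLS` at `(p, 4)` once the kernel lines pass: at `t = s₃ = 0` the
plain form `ladderOK p p d 0 S S5 0 0`, and at every `t ∈ [1, P]` the form with the kill of `mk t ≤ t` triangles. -/
theorem rls_of_kill_case (M : Matroid α) [M.Finite] {p d : ℕ}
    (hR : M.eRank = (p : ℕ∞)) (hn : M.E.ncard = p + d)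
    (hfree : ∀ e ∈ M.E, ∃ A ⊆ M.E \ {e}, e ∉ M.closure A ∧ e ∉ M.closure ((M.E \ {e}) \ A))
    (hc : M.coloops = ∅) (hp : 5 ≤ p) (hd4 : 4 ≤ d) {P S S5 : ℕ}
    (hP : min ((p + d) * TriangleCap.cq3 (d - 1) / (p + d - 3)) (TriangleCap.cq3 d) ≤ P)
    (hScap : ∀ (N : Matroid α) [N.Finite],
      (∀ e ∈ N.E, ∃ A ⊆ N.E \ {e}, e ∉ N.closure A ∧ e ∉ N.closure ((N.E \ {e}) \ A)) →
      N.E.encard = N.eRank + ((d : ℕ) : ℕ∞) → N.E.ncard = p + d → N.coloops = ∅ →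
      {C : Set α | N.IsCircuit C ∧ C.ncard = 4}.ncard ≤ S)
    (hS5 : (p + d) * avgChain5b (d - 1) / (p + d - 5) ≤ S5)
    (mk : ℕ → ℕ) (hmk : ∀ t ∈ Finset.Icc 1 P, 1 ≤ mk t ∧ mk t ≤ t)
    (hzero : ladderOK p p d 0 S S5 0 0 = true)
    (hok : ∀ t ∈ Finset.Icc 1 P, ladderOK p p d t S S5 (mk t * (p + d - 3).choose (p - 3))
      ((mk t).choose 2 * (p + d - 5).choose (p - 5)) = true) :
    ThmN.RLS M p 4 := by
  have hd : M.E.encard = M.eRank + ((d - 1 + 1 : ℕ) : ℕ∞) := by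
    rw [hR, ← M.ground_finite.cast_ncard_eq, hn, show d - 1 + 1 = d by omega]
    push_cast
    ring
  have hd' : M.E.encard = M.eRank + (((d - 1 : ℕ) : ℕ∞) + 1) := by rw [hd, Nat.cast_succ]
  have hdd : M.E.encard = M.eRank + ((d : ℕ) : ℕ∞) := by rw [hd, show d - 1 + 1 = d by omega]
  have hP' : {C : Set α | M.IsCircuit C ∧ C.ncard = 3}.ncard ≤ P :=
    (le_min (ncard_triangles_le_of_coloopFree M hfree hd hc hn (by omega))
      (TriangleCap.core_ncard_triangles_le_cq3 M hfree hdd)).trans hP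
  have hS' := hScap M hfree hdd hn hc
  have hS5' := (ncard_fiveCircuits_le_of_coloopFree M hfree hd' hc hn (by omega)).trans hS5
  set t := {C : Set α | M.IsCircuit C ∧ C.ncard = 3}.ncard with ht
  rw [ThmN.RLS_iff]
  rcases Nat.eq_zero_or_pos t with h0 | hpos
  · have hw := weighted_of_ladderOK M p p d 0 S S5 0 0 hd4 hR hn hfree (by rw [← ht, h0]) hS' hS5' hp hp hzero
    simpa using hw
  · have htI : t ∈ Finset.Icc 1 P := Finset.mem_Icc.2 ⟨hpos, hP'⟩
    obtain ⟨hm1, hmt⟩ := hmk t htI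
    obtain ⟨𝒯, h𝒯card, h𝒯mem⟩ := exists_finset_of_le_ncard hm1 (hmt.trans (le_of_eq ht))
    have hw := weighted_of_ladderOK_kill M p p d t S S5 0 0 hd4 hR hn hfree le_rfl hS' hS5' hp hp 3 (by omega) 𝒯
      (fun C hC => h𝒯mem C hC)
      (fun C hC C' hC' hne => five_le_ncard_union_of_triangles M
        (fun L hL hr => by
          have := ThmN.ncard_add_one_le_two_pow_of_eRk_le M (ThmN.not_isLoop_of_free M hfree) hfree 2 L hL hr.le
          omega)
        (h𝒯mem C hC) (h𝒯mem C' hC') hne)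
      (by rw [h𝒯card]; simpa using hok t htI)
    simpa using hw

/-- **THE COLOOP-FREE CASE WITH THE FOUR-CIRCUITS AT `s₃ = 0`**: as `rls_of_kill_case`, but the line `s₃ = 0`
splits by the four-circuit count `u = s₄`: `u ≤ u₀` by the plain form with the cap `u₀`, `u > u₀` by the kill of
`m₀ ≤ u₀ + 1` four-circuits at the cap `S`. -/
theorem rls_of_kill_case_four (M : Matroid α) [M.Finite] {p d : ℕ}
    (hR : M.eRank = (p : ℕ∞)) (hn : M.E.ncard = p + d)
    (hfree : ∀ e ∈ M.E, ∃ A ⊆ M.E \ {e}, e ∉ M.closure A ∧ e ∉ M.closure ((M.E \ {e}) \ A))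
    (hc : M.coloops = ∅) (hp : 5 ≤ p) (hd4 : 4 ≤ d) {P S S5 : ℕ}
    (hP : min ((p + d) * TriangleCap.cq3 (d - 1) / (p + d - 3)) (TriangleCap.cq3 d) ≤ P)
    (hScap : ∀ (N : Matroid α) [N.Finite],
      (∀ e ∈ N.E, ∃ A ⊆ N.E \ {e}, e ∉ N.closure A ∧ e ∉ N.closure ((N.E \ {e}) \ A)) →
      N.E.encard = N.eRank + ((d : ℕ) : ℕ∞) → N.E.ncard = p + d → N.coloops = ∅ →
      {C : Set α | N.IsCircuit C ∧ C.ncard = 4}.ncard ≤ S)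
    (hS5 : (p + d) * avgChain5b (d - 1) / (p + d - 5) ≤ S5)
    (mk : ℕ → ℕ) (hmk : ∀ t ∈ Finset.Icc 1 P, 1 ≤ mk t ∧ mk t ≤ t)
    {u₀ m₀ : ℕ} (hm₀ : 1 ≤ m₀ ∧ m₀ ≤ u₀ + 1)
    (hsmall : ladderOK p p d 0 u₀ S5 0 0 = true)
    (hbig : ladderOK p p d 0 S S5 (m₀ * (p + d - 4).choose (p - 4)) (m₀.choose 2 * (p + d - 5).choose (p - 5)) = true)
    (hok : ∀ t ∈ Finset.Icc 1 P, ladderOK p p d t S S5 (mk t * (p + d - 3).choose (p - 3))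
      ((mk t).choose 2 * (p + d - 5).choose (p - 5)) = true) :
    ThmN.RLS M p 4 := by
  have hd : M.E.encard = M.eRank + ((d - 1 + 1 : ℕ) : ℕ∞) := by
    rw [hR, ← M.ground_finite.cast_ncard_eq, hn, show d - 1 + 1 = d by omega]
    push_cast
    ring
  have hd' : M.E.encard = M.eRank + (((d - 1 : ℕ) : ℕ∞) + 1) := by rw [hd, Nat.cast_succ]
  have hdd : M.E.encard = M.eRank + ((d : ℕ) : ℕ∞) := by rw [hd, show d - 1 + 1 = d by omega]
  have hP' : {C : Set α | M.IsCircuit C ∧ C.ncard = 3}.ncard ≤ P :=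
    (le_min (ncard_triangles_le_of_coloopFree M hfree hd hc hn (by omega))
      (TriangleCap.core_ncard_triangles_le_cq3 M hfree hdd)).trans hP
  have hS' := hScap M hfree hdd hn hc
  have hS5' := (ncard_fiveCircuits_le_of_coloopFree M hfree hd' hc hn (by omega)).trans hS5
  set t := {C : Set α | M.IsCircuit C ∧ C.ncard = 3}.ncard with ht
  set u := {C : Set α | M.IsCircuit C ∧ C.ncard = 4}.ncard with hu
  rw [ThmN.RLS_iff]
  rcases Nat.eq_zero_or_pos t with h0 | hpos
  · rcases Nat.lt_or_ge u₀ u with hbigu | hsmallu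
    · obtain ⟨𝒯, h𝒯card, h𝒯mem⟩ := exists_finset_of_le_ncard hm₀.1 (show m₀ ≤ u by omega)
      have hw := weighted_of_ladderOK_kill M p p d 0 S S5 0 0 hd4 hR hn hfree (by rw [← ht, h0]) hS' hS5' hp hp 4
        (by omega) 𝒯 (fun C hC => h𝒯mem C hC)
        (fun C hC C' hC' hne => five_le_ncard_union_of_four_circuits M (h𝒯mem C hC) (h𝒯mem C' hC') hne)
        (by rw [h𝒯card]; simpa using hbig)
      simpa using hw
    · have hw := weighted_of_ladderOK M p p d 0 u₀ S5 0 0 hd4 hR hn hfree (by rw [← ht, h0]) hsmallu hS5' hp hp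
        hsmall
      simpa using hw
  · have htI : t ∈ Finset.Icc 1 P := Finset.mem_Icc.2 ⟨hpos, hP'⟩
    obtain ⟨hm1, hmt⟩ := hmk t htI
    obtain ⟨𝒯, h𝒯card, h𝒯mem⟩ := exists_finset_of_le_ncard hm1 (hmt.trans (le_of_eq ht))
    have hw := weighted_of_ladderOK_kill M p p d t S S5 0 0 hd4 hR hn hfree le_rfl hS' hS5' hp hp 3 (by omega) 𝒯
      (fun C hC => h𝒯mem C hC)
      (fun C hC C' hC' hne => five_le_ncard_union_of_triangles M
        (fun L hL hr => by
          have := ThmN.ncard_add_one_le_two_pow_of_eRk_le M (ThmN.not_isLoop_of_free M hfree) hfree 2 L hL hr.le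
          omega)
        (h𝒯mem C hC) (h𝒯mem C' hC') hne)
      (by rw [h𝒯card]; simpa using hok t htI)
    simpa using hw

end S1

end PercRepro
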